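import Summits.CriticalPhenomena.PercolationContinuityZ3.Theorems.PercNearOneGluingNoHeavyLowerTailThreePointProductFormFibreDangling
import HarnessLib

/-!
# The product form `#bad² ≤ #P1·#P2` in the fibre language: A PART HANGING AT ANY VERTEX IS IRRELEVANT
# (Sahi programme, prover prim-sahi-p2 gen 54)

Support file (`--supports stmt-CriticalPhenomena-4575`, helper); generalises `…ThreePointProductFormFibreDangling` (part hanging at the apex)
to a part hanging at an ARBITRARY vertex `v` (a terminal or not).  Standard axioms, no sorries, no named facts, no definitions.
Memo `run/shared/lean/prim/prim-sahi/FROM-prim-sahi-p2-gen54-CERTIFICATE-SHAPE.md` §5.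

SETTING.  `D ⊆ V` hangs at the vertex `v`: the labels are classified by `inD` into those inside `D ∪ {v}` (`hD1`) and those inside `Dᶜ ∪ {v}`
(`hD2`); the three terminals `a, s, c` lie in `Dᶜ ∪ {v}` (each is either outside `D` and different from `v`, or equal to `v`).  The reduced
multigraph `H°` makes the `D`-labels loops at `v` (`fun l => if inD l then s(v, v) else ends l`).
* `reachable_iff_restrict'` [this work] — connections between vertices of `(Dᶜ ∖ {v}) ∪ {v}` use only labels outside `D`
  (`reachable_iff_restrict` / `reachable_apex_iff_restrict` of the Dangling file, read with attachment vertex `v`).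
* `flat_eq_flat_loops_at` [this work] — the flats of the apex `a` in `H` and in `H°` agree on the labels outside `D`.
* **`bad_iff_hanging`, `sa_iff_hanging`, `productForm_of_hanging`** [this work] — `bad, P1, P2` are the same events in `H` and `H°`, so the
  three counts agree and `(P)` transfers from `H°` to `H`.  With `v = a` this is `productForm_of_dangling`; with `v ∉ {a, s, c}` it removes
  blocks hanging off non-terminal cut vertices; with `v = s` or `v = c` it removes parts hanging at a terminal.
[folklore] (a part attached at one vertex carries no connection between other vertices); [cite: Gladkov2024, Conjecture 10.1 (p. 18), arXiv:2408.08457] for (P).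
-/

namespace Summit.CriticalPhenomena.PercolationContinuityZ3.Theorems.ProductFormFibre

open Finset Literature.Probability.Percolation
open Summit.CriticalPhenomena.PercolationContinuityZ3.Theorems.ThreePointCPIClusterSwap
  (QTouch clusterFlip clusterFlip_of_qtouch clusterFlip_of_not_qtouch)

variable {V α : Type*}

section Hanging

variable [DecidableEq V] (ends : α → Sym2 V) (v : V) (D : Set V) (inD : α → Prop) [DecidablePred inD]

/-- **Connections inside `(Dᶜ ∖ {v}) ∪ {v}` only use labels outside `D`** (both endpoints may be the attachment vertex). [this work] -/
theorem reachable_iff_restrict' (hD1 : ∀ l, inD l → ∀ u ∈ ends l, u ∈ D ∨ u = v)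
    (hD2 : ∀ l, ¬ inD l → ∀ u ∈ ends l, u ∉ D ∨ u = v) (w : α → Bool) {x y : V}
    (hx : (x ∉ D ∧ x ≠ v) ∨ x = v) (hy : (y ∉ D ∧ y ≠ v) ∨ y = v) :
    (openGraph (labelledOpen ends w)).Reachable x y ↔
      (openGraph (labelledOpen ends fun l => if inD l then false else w l)).Reachable x y := by
  rcases hx with hx | rfl
  · rcases hy with hy | rfl
    · exact reachable_iff_restrict ends v D inD hD1 hD2 w hx hy
    · have h := reachable_apex_iff_restrict ends y D inD hD1 hD2 w (Or.inl hx)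
      exact ⟨fun hr => (h.1 hr.symm).symm, fun hr => (h.2 hr.symm).symm⟩
  · exact reachable_apex_iff_restrict ends x D inD hD1 hD2 w hy

/-- **The flats of the apex `a` in `H` and in `H°` agree on the labels outside `D`.** [this work] -/
theorem flat_eq_flat_loops_at (hD1 : ∀ l, inD l → ∀ u ∈ ends l, u ∈ D ∨ u = v)
    (hD2 : ∀ l, ¬ inD l → ∀ u ∈ ends l, u ∉ D ∨ u = v) (a : V) (ha : (a ∉ D ∧ a ≠ v) ∨ a = v)
    (z : α → Bool) {l : α} (hin : ¬ inD l) :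
    clusterFlip ends a (fun x => !z x) l = clusterFlip (fun l => if inD l then s(v, v) else ends l) a (fun x => !z x) l := by
  classical
  have hq : QTouch ends a (fun x => !z x) l ↔ QTouch (fun l => if inD l then s(v, v) else ends l) a (fun x => !z x) l := by
    rw [qtouch_compl_iff, qtouch_compl_iff]
    simp only [hin, if_false]
    have key : ∀ u ∈ ends l, ((openGraph (labelledOpen ends z)).Reachable a u ↔
        (openGraph (labelledOpen (fun l => if inD l then s(v, v) else ends l) z)).Reachable a u) := by
      intro u hu
      rw [openGraph_loops_eq ends v inD z]
      have hu' : (u ∉ D ∧ u ≠ v) ∨ u = v := by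
        by_cases huv : u = v
        · exact Or.inr huv
        · rcases hD2 l hin u hu with h | h
          · exact Or.inl ⟨h, huv⟩
          · exact absurd h huv
      exact reachable_iff_restrict' ends v D inD hD1 hD2 z ha hu'
    constructor
    · rintro ⟨u, hu, hr⟩; exact ⟨u, hu, (key u hu).1 hr⟩
    · rintro ⟨u, hu, hr⟩; exact ⟨u, hu, (key u hu).2 hr⟩
  by_cases hq1 : QTouch ends a (fun x => !z x) l
  · rw [clusterFlip_of_qtouch ends a _ hq1, clusterFlip_of_qtouch _ a _ (hq.1 hq1)]
  · rw [clusterFlip_of_not_qtouch ends a _ hq1, clusterFlip_of_not_qtouch _ a _ (fun h' => hq1 (hq.2 h'))]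

/-- **`bad` is the same event in `H` and in `H°`** (terminals in `(Dᶜ ∖ {v}) ∪ {v}`). [this work] -/
theorem bad_iff_hanging (hD1 : ∀ l, inD l → ∀ u ∈ ends l, u ∈ D ∨ u = v)
    (hD2 : ∀ l, ¬ inD l → ∀ u ∈ ends l, u ∉ D ∨ u = v) {a s c : V}
    (ha : (a ∉ D ∧ a ≠ v) ∨ a = v) (hs : (s ∉ D ∧ s ≠ v) ∨ s = v) (hc : (c ∉ D ∧ c ≠ v) ∨ c = v) (z : α → Bool) :
    ((¬ (openGraph (labelledOpen ends z)).Reachable a s ∧ ¬ (openGraph (labelledOpen ends z)).Reachable a c ∧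
        ¬ (openGraph (labelledOpen ends z)).Reachable s c) ∧
      (openGraph (labelledOpen ends (clusterFlip ends a fun x => !z x))).Reachable s c) ↔
    ((¬ (openGraph (labelledOpen (fun l => if inD l then s(v, v) else ends l) z)).Reachable a s ∧
        ¬ (openGraph (labelledOpen (fun l => if inD l then s(v, v) else ends l) z)).Reachable a c ∧
        ¬ (openGraph (labelledOpen (fun l => if inD l then s(v, v) else ends l) z)).Reachable s c) ∧
      (openGraph (labelledOpen (fun l => if inD l then s(v, v) else ends l)
        (clusterFlip (fun l => if inD l then s(v, v) else ends l) a fun x => !z x))).Reachable s c) := by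
  classical
  rw [openGraph_loops_eq ends v inD z, openGraph_loops_eq ends v inD,
    ← reachable_iff_restrict' ends v D inD hD1 hD2 z ha hs,
    ← reachable_iff_restrict' ends v D inD hD1 hD2 z ha hc,
    ← reachable_iff_restrict' ends v D inD hD1 hD2 z hs hc]
  have hfl : (fun l => if inD l then false else clusterFlip (fun l => if inD l then s(v, v) else ends l) a (fun x => !z x) l) =
      (fun l => if inD l then false else clusterFlip ends a (fun x => !z x) l) :=
    restrict_eq_of_agree inD fun l hin => (flat_eq_flat_loops_at ends v D inD hD1 hD2 a ha z hin).symm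
  rw [hfl, ← reachable_iff_restrict' ends v D inD hD1 hD2 _ hs hc]

/-- **`{a ↔ s, a ↮ c}` is the same event in `H` and in `H°`** (and so is `P2`, exchanging `s, c`). [this work] -/
theorem sa_iff_hanging (hD1 : ∀ l, inD l → ∀ u ∈ ends l, u ∈ D ∨ u = v)
    (hD2 : ∀ l, ¬ inD l → ∀ u ∈ ends l, u ∉ D ∨ u = v) {a s c : V}
    (ha : (a ∉ D ∧ a ≠ v) ∨ a = v) (hs : (s ∉ D ∧ s ≠ v) ∨ s = v) (hc : (c ∉ D ∧ c ≠ v) ∨ c = v) (z : α → Bool) :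
    ((openGraph (labelledOpen ends z)).Reachable a s ∧ ¬ (openGraph (labelledOpen ends z)).Reachable a c) ↔
    ((openGraph (labelledOpen (fun l => if inD l then s(v, v) else ends l) z)).Reachable a s ∧
      ¬ (openGraph (labelledOpen (fun l => if inD l then s(v, v) else ends l) z)).Reachable a c) := by
  rw [openGraph_loops_eq ends v inD z,
    ← reachable_iff_restrict' ends v D inD hD1 hD2 z ha hs,
    ← reachable_iff_restrict' ends v D inD hD1 hD2 z ha hc]

end Hanging

/-! ### The transfer of (P) -/

section Transfer

variable [Fintype α] [DecidableEq α] [DecidableEq V]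

open Classical in
/-- **A PART HANGING AT ANY VERTEX IS IRRELEVANT FOR (P).**  With `D` hanging at `v` (labels classified by `inD`: inside `D ∪ {v}` /
inside `Dᶜ ∪ {v}`) and the terminals `a, s, c` in `(Dᶜ ∖ {v}) ∪ {v}`, the three counts `#bad, #P1, #P2` of `H` equal those of the
reduced multigraph `H°` (the `D`-labels made loops at `v`); in particular `(P)` for `H°` implies `(P)` for `H`.  (`v = a`:
`productForm_of_dangling`; `v ∉ {a, s, c}`: blocks hanging off a non-terminal cut vertex; `v ∈ {s, c}`: parts hanging at a terminal.) [this work] -/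
theorem productForm_of_hanging (ends : α → Sym2 V) (v a s c : V) (D : Set V) (inD : α → Prop)
    (hD1 : ∀ l, inD l → ∀ u ∈ ends l, u ∈ D ∨ u = v) (hD2 : ∀ l, ¬ inD l → ∀ u ∈ ends l, u ∉ D ∨ u = v)
    (ha : (a ∉ D ∧ a ≠ v) ∨ a = v) (hs : (s ∉ D ∧ s ≠ v) ∨ s = v) (hc : (c ∉ D ∧ c ≠ v) ∨ c = v)
    (hP : (univ.filter fun z : α → Bool =>
        (¬ (openGraph (labelledOpen (fun l => if inD l then s(v, v) else ends l) z)).Reachable a s ∧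
            ¬ (openGraph (labelledOpen (fun l => if inD l then s(v, v) else ends l) z)).Reachable a c ∧
            ¬ (openGraph (labelledOpen (fun l => if inD l then s(v, v) else ends l) z)).Reachable s c) ∧
          (openGraph (labelledOpen (fun l => if inD l then s(v, v) else ends l)
            (clusterFlip (fun l => if inD l then s(v, v) else ends l) a fun x => !z x))).Reachable s c).card ^ 2 ≤
      (univ.filter fun z : α → Bool =>
        (openGraph (labelledOpen (fun l => if inD l then s(v, v) else ends l) z)).Reachable a s ∧
          ¬ (openGraph (labelledOpen (fun l => if inD l then s(v, v) else ends l) z)).Reachable a c).card *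
      (univ.filter fun z : α → Bool =>
        (openGraph (labelledOpen (fun l => if inD l then s(v, v) else ends l) z)).Reachable a c ∧
          ¬ (openGraph (labelledOpen (fun l => if inD l then s(v, v) else ends l) z)).Reachable a s).card) :
    (univ.filter fun z : α → Bool =>
        (¬ (openGraph (labelledOpen ends z)).Reachable a s ∧ ¬ (openGraph (labelledOpen ends z)).Reachable a c ∧
          ¬ (openGraph (labelledOpen ends z)).Reachable s c) ∧
        (openGraph (labelledOpen ends (clusterFlip ends a fun x => !z x))).Reachable s c).card ^ 2 ≤
    (univ.filter fun z : α → Bool =>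
        (openGraph (labelledOpen ends z)).Reachable a s ∧ ¬ (openGraph (labelledOpen ends z)).Reachable a c).card *
    (univ.filter fun z : α → Bool =>
        (openGraph (labelledOpen ends z)).Reachable a c ∧ ¬ (openGraph (labelledOpen ends z)).Reachable a s).card := by
  have e1 := Finset.filter_congr (s := (univ : Finset (α → Bool)))
    fun z _ => bad_iff_hanging ends v D inD hD1 hD2 ha hs hc z
  have e2 := Finset.filter_congr (s := (univ : Finset (α → Bool)))
    fun z _ => sa_iff_hanging ends v D inD hD1 hD2 ha hs hc z
  have e3 := Finset.filter_congr (s := (univ : Finset (α → Bool)))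
    fun z _ => sa_iff_hanging ends v D inD hD1 hD2 ha hc hs z
  rw [e1, e2, e3]
  exact hP

end Transfer

end Summit.CriticalPhenomena.PercolationContinuityZ3.Theorems.ProductFormFibre
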